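import Summits.HodgeConjecture.HodgeConjecture.Theorems.PadicSemiregularLiftHodgeFermatVarietiesPQFibre
import Summits.HodgeConjecture.HodgeConjecture.Theorems.PadicSemiregularLiftHodgeFermatVarietiesPQUnits
import Literature.AlgebraicGeometry.HodgeTheory.FermatFourfoldFiveStandardSextuples
import HarnessLib

/-!
# Hodge `(p+1)`-tuples of level `pq`, V: the classification — `(p+1)/2` pairs or Aoki's standard element `σ_{p,a}`, line `cancel-by-any-claim-lattice`, crux `HodgeFermatVarieties` (stmt-HodgeConjecture-1334)

Fifth and last file of the LEVEL-`pq` programme (primes `5 ≤ p`, `p + 2 < q`), stub S14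
`stub_pqClassification` of skeleton generation 12. THEOREM (`stub_pqClassification`): every Hodge multiset
`s` of `p + 1` elements of `ℤ/pq` (the Hodge characters of the Fermat `(p-1)`-fold `X^{p-1}_{pq}`) is

* a sum of pairs `{a, -a}` (all `a ≠ 0`), or
* Aoki's standard multiset `σ_{p,a} = {a + i q : i < p} + {-p a}` for a unit `a` (written in the spelling
  of the line's printed supply, `{a + i (pq/p) : i < p} + {-(p a)}`).

Word for word the level-`5q` file `FiveQClassification` with `5 ↦ p`. Proof: `PQ.structure_units_pq` (the unit
part is symmetric, or one whole fibre `F = {x unit : x ≡ b₁ (q)}` is occupied and the multiplicities are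
symmetric off the fibres of `±b₁`) + the symmetric case `PQ.exists_pairs_of_symmetric_pq` (pairs) + the
occupied fibre `PQ.exists_eq_fibre_add_pair` / `PQ.pair_level_q_pq` (`s = F + {y, z}` with `y, z` of level
`q`, `ȳ + z̄ = (1 - p) b₁`); here the last step — the relation (II) at conductor `q`
(`FiveQ.stub_twoPrime_level_right`, general in `p`) identifies the two level-`q` entries: the function
`Φ = 𝟙_{p b₁} - 𝟙_{b₁} + 𝟙_{ȳ} + 𝟙_{z̄}` on `ℤ/q` is orthogonal to the odd characters, hence even
(`FiveQ.even_of_orthogonal_odd`), and evaluating at `±b₁` (using `(p-1) b₁, (p+1) b₁, 2 b₁ ≠ 0`, i.e.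
`0 < k ≤ p + 1 < q`) gives `ȳ = b₁` or `z̄ = b₁`; then `z̄ = -p b₁`, so `y` is the missing (non-unit) point
of the full fibre `{a + i q}` over `b₁` and `z = -p a` by CRT.

The reachability / Hodge-conjecture pay-off (S15 `stub_reachPQ`, HC for `X^{p-1}_{pq}` modulo the printed
facts) is in `…PQPayoff`.

References: [Aoki1983] N. Aoki, Math. Ann. 266 (1983) §2 Prop. 2.2, Thm A′ (§7); [Aoki1987] N. Aoki,
J. Math. Soc. Japan 39 (1987) §1 p. 387 (standard elements).
-/

set_option linter.dupNamespace false

noncomputable section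

open Finset
open Literature.AlgebraicGeometry.HodgeTheory Literature.AlgebraicGeometry.HodgeTheory.FermatCharacter
open Summit.HodgeConjecture.HodgeConjecture.Theorems.CancelByAnyClaimLattice.FiveQ

namespace Summit.HodgeConjecture.HodgeConjecture.Theorems.CancelByAnyClaimLattice.PQ

section LevelPQ

variable {p q : ℕ} [Fact p.Prime] [Fact q.Prime]

/-! ### §1 (II) identifies the two level-`q` entries -/

/-- **The reductions of the two level-`q` entries are `b₁` and `-p b₁`** (up to order): the relation (II)
for `s = F + {y, z}` reads `(p - 1)((χ(p) - 1)χ(b₁) + χ(ȳ) + χ(z̄)) = 0` for every odd `χ` mod `q`, so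
`Φ = 𝟙_{p b₁} - 𝟙_{b₁} + 𝟙_ȳ + 𝟙_z̄` is even; evaluating at `±b₁` gives `ȳ = b₁` or `z̄ = b₁`.
[cite: Aoki1983, Prop. 2.2] -/
theorem casts_pair_eq (hp : 5 ≤ p) (hpq' : p + 2 < q) {s : Multiset (ZMod (p * q))} (hs : IsHodgeMultiset s)
    {b₁ : (ZMod q)ˣ} {y z : ZMod (p * q)}
    (hsyz : s = (univ.filter fun x : (ZMod (p * q))ˣ ↦ ZMod.unitsMap (dvd_mul_left q p) x = b₁).val.map
      (fun x : (ZMod (p * q))ˣ ↦ (x : ZMod (p * q))) + {y, z})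
    (hy : ¬ IsUnit y) (hz : ¬ IsUnit z) :
    ZMod.castHom (dvd_mul_left q p) (ZMod q) y = b₁ ∨ ZMod.castHom (dvd_mul_left q p) (ZMod q) z = b₁ := by
  classical
  have hpq : p ≠ q := by omega
  set yq := ZMod.castHom (dvd_mul_left q p) (ZMod q) y with hyq
  set zq := ZMod.castHom (dvd_mul_left q p) (ZMod q) z with hzq
  by_contra hnot
  push Not at hnot
  obtain ⟨hyb, hzb⟩ := hnot
  -- `Φ` is orthogonal to the odd characters mod `q`
  set Φ : ZMod q → ℂ := fun t ↦ (if t = (p : ZMod q) * (b₁ : ZMod q) then 1 else 0) -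
    (if t = (b₁ : ZMod q) then 1 else 0) + (if t = yq then 1 else 0) + (if t = zq then 1 else 0) with hΦ
  have horth : ∀ ψ : DirichletCharacter ℂ q, ψ (-1) = -1 → ∑ t : ZMod q, Φ t * ψ t = 0 := by
    intro ψ hψ
    have hΦsum : ∑ t : ZMod q, Φ t * ψ t =
        ψ ((p : ZMod q) * (b₁ : ZMod q)) - ψ (b₁ : ZMod q) + ψ yq + ψ zq := by
      simp only [hΦ, sub_mul, add_mul, ite_mul, one_mul, zero_mul, Finset.sum_add_distrib,
        Finset.sum_sub_distrib, Finset.sum_ite_eq', Finset.mem_univ, if_true]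
    rw [hΦsum]
    -- (II) for `χ = ψ⁻¹` on `s = F + {y, z}`
    have h2 := stub_twoPrime_level_right p q hpq s hs ψ⁻¹ (inv_neg_one_of_odd hψ)
      (ne_one_of_odd (inv_neg_one_of_odd hψ))
    rw [hsyz, Multiset.map_add, Multiset.sum_add] at h2
    -- the fibre part
    have hF : ((univ.filter fun x : (ZMod (p * q))ˣ ↦ ZMod.unitsMap (dvd_mul_left q p) x = b₁).val.map
        (fun x : (ZMod (p * q))ˣ ↦ (x : ZMod (p * q)))).map (fun x ↦
          (if IsUnit x then (1 - ψ⁻¹ ((p : ℕ) : ZMod q)) else ((p - 1 : ℕ) : ℂ) * ψ⁻¹ ((p : ℕ) : ZMod q)) *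
            (ψ⁻¹ (ZMod.castHom (dvd_mul_left q p) (ZMod q) x))⁻¹) =
        ((univ.filter fun x : (ZMod (p * q))ˣ ↦ ZMod.unitsMap (dvd_mul_left q p) x = b₁).val.map
          fun _ ↦ (1 - ψ⁻¹ ((p : ℕ) : ZMod q)) * ψ (b₁ : ZMod q)) := by
      rw [Multiset.map_map]
      refine Multiset.map_congr rfl fun x hx ↦ ?_
      simp only [Finset.mem_val, mem_filter, mem_univ, true_and] at hx
      rw [Function.comp_apply, if_pos (Units.isUnit x), inv_inv_apply, ← coe_unitsMap, hx]
    have hFsum : (((univ.filter fun x : (ZMod (p * q))ˣ ↦ ZMod.unitsMap (dvd_mul_left q p) x = b₁).val.map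
          fun _ ↦ (1 - ψ⁻¹ ((p : ℕ) : ZMod q)) * ψ (b₁ : ZMod q))).sum =
        ((p - 1 : ℕ) : ℂ) * ((1 - ψ⁻¹ ((p : ℕ) : ZMod q)) * ψ (b₁ : ZMod q)) := by
      rw [Multiset.map_const', Multiset.sum_replicate, Finset.card_val, card_fibre hpq b₁, nsmul_eq_mul]
    -- the pair part
    have hP : (({y, z} : Multiset (ZMod (p * q))).map fun x ↦
        (if IsUnit x then (1 - ψ⁻¹ ((p : ℕ) : ZMod q)) else ((p - 1 : ℕ) : ℂ) * ψ⁻¹ ((p : ℕ) : ZMod q)) *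
          (ψ⁻¹ (ZMod.castHom (dvd_mul_left q p) (ZMod q) x))⁻¹).sum =
        ((p - 1 : ℕ) : ℂ) * ψ⁻¹ ((p : ℕ) : ZMod q) * (ψ yq + ψ zq) := by
      simp only [Multiset.insert_eq_cons, Multiset.map_cons, Multiset.map_singleton, Multiset.sum_cons,
        Multiset.sum_singleton, if_neg hy, if_neg hz, inv_inv_apply]
      rw [← hyq, ← hzq]
      ring
    rw [hF, hFsum, hP] at h2
    -- `ψ⁻¹(p) = ψ(p)⁻¹` with `ψ(p) ≠ 0`, and `p - 1 ≠ 0`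
    have hpu : IsUnit ((p : ℕ) : ZMod q) := by
      rw [ZMod.isUnit_prime_iff_not_dvd (Fact.out : p.Prime)]
      intro h
      exact hpq ((Nat.prime_dvd_prime_iff_eq (Fact.out : p.Prime) Fact.out).mp h)
    have hψp : ψ ((p : ℕ) : ZMod q) ≠ 0 := (hpu.map ψ).ne_zero
    have hp1 : ((p - 1 : ℕ) : ℂ) ≠ 0 := by
      have : (p - 1 : ℕ) ≠ 0 := by omega
      exact_mod_cast this
    rw [MulChar.inv_apply_eq_inv'] at h2
    have key : (ψ ((p : ℕ) : ZMod q) - 1) * ψ (b₁ : ZMod q) + ψ yq + ψ zq = 0 := by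
      have h3 : ((p - 1 : ℕ) : ℂ) * ((ψ ((p : ℕ) : ZMod q) - 1) * ψ (b₁ : ZMod q) + ψ yq + ψ zq) =
          ψ ((p : ℕ) : ZMod q) * (((p - 1 : ℕ) : ℂ) * ((1 - (ψ ((p : ℕ) : ZMod q))⁻¹) * ψ (b₁ : ZMod q)) +
            ((p - 1 : ℕ) : ℂ) * (ψ ((p : ℕ) : ZMod q))⁻¹ * (ψ yq + ψ zq)) := by
        field_simp
        ring
      rw [h2, mul_zero] at h3
      exact (mul_eq_zero.mp h3).resolve_left hp1
    rw [map_mul]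
    linear_combination key
  -- evenness of `Φ` at `b₁`
  have heven := even_of_orthogonal_odd Φ horth b₁
  -- evaluate both sides: `(p - 1) b₁, (p + 1) b₁, 2 b₁ ≠ 0`
  have h4 : (b₁ : ZMod q) ≠ (p : ZMod q) * (b₁ : ZMod q) := fun h ↦
    coef_mul_ne_zero (cast_sub_one_ne_zero hpq') b₁ (by linear_combination -h)
  have h6 : -(b₁ : ZMod q) ≠ (p : ZMod q) * (b₁ : ZMod q) := fun h ↦
    coef_mul_ne_zero (cast_add_one_ne_zero hpq') b₁ (by linear_combination -h)
  have h2' : -(b₁ : ZMod q) ≠ (b₁ : ZMod q) := fun h ↦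
    coef_mul_ne_zero (two_ne_zero' hpq') b₁ (by linear_combination -h)
  have hL : Φ (b₁ : ZMod q) = -1 := by
    simp only [hΦ, if_neg h4, if_neg (Ne.symm hyb), if_neg (Ne.symm hzb)]
    norm_num
  have hR : Φ (-(b₁ : ZMod q)) =
      (if -(b₁ : ZMod q) = yq then 1 else 0) + (if -(b₁ : ZMod q) = zq then 1 else 0) := by
    simp only [hΦ, if_neg h6, if_neg h2']
    norm_num
  rw [hL, hR] at heven
  split_ifs at heven <;> norm_num at heven

/-! ### §2 Assembly into the standard multiset `σ_{p,a}` -/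

/-- **The full fibre of `ℤ/pq → ℤ/q` over a unit residue `b₁`**, written as Aoki's progression
`{a + i q : i < p}` for a unit `a` of the fibre, is the unit fibre plus the one point `≡ 0 (mod p)`.
[cite: Aoki1987, §1 p. 387] -/
theorem fibre_add_point_eq_range_map (hpq : p ≠ q) {b₁ : (ZMod q)ˣ} (a : (ZMod (p * q))ˣ)
    (ha : ZMod.unitsMap (dvd_mul_left q p) a = b₁) {y : ZMod (p * q)}
    (hyp : ZMod.castHom (dvd_mul_right p q) (ZMod p) y = 0)
    (hyq : ZMod.castHom (dvd_mul_left q p) (ZMod q) y = b₁) :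
    (univ.filter fun x : (ZMod (p * q))ˣ ↦ ZMod.unitsMap (dvd_mul_left q p) x = b₁).val.map
        (fun x : (ZMod (p * q))ˣ ↦ (x : ZMod (p * q))) + {y} =
      (Multiset.range p).map fun i : ℕ ↦
        (a : ZMod (p * q)) + (i : ZMod (p * q)) * ((p * q / p : ℕ) : ZMod (p * q)) := by
  classical
  have hp0 : 0 < p := (Fact.out : p.Prime).pos
  have hqq : p * q / p = q := Nat.mul_div_cancel_left q hp0
  rw [range_map_eq_filter_of_dvd_one (dvd_mul_right p q) (a : ZMod (p * q))]
  -- membership in the full fibre is `x ≡ a (mod q)`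
  have hmem : ∀ x : ZMod (p * q), x.val % (p * q / p) = (a : ZMod (p * q)).val % (p * q / p) ↔
      ZMod.castHom (dvd_mul_left q p) (ZMod q) x = b₁ := by
    intro x
    rw [hqq, ← ZMod.natCast_eq_natCast_iff', ZMod.castHom_apply, ZMod.cast_eq_val]
    have : ((a : ZMod (p * q)).val : ZMod q) = (b₁ : ZMod q) := by
      rw [← ZMod.cast_eq_val, ← ZMod.castHom_apply (h := dvd_mul_left q p), ← coe_unitsMap, ha]
    rw [this]
  have hy0 : y ≠ 0 := fun h ↦ by rw [h, map_zero] at hyq; exact (Units.ne_zero b₁) hyq.symm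
  have hyu : ¬ IsUnit y := fun h ↦ cast_ne_zero_of_isUnit' h hyp
  ext x
  rw [Multiset.count_add, count_fibreMultiset, Multiset.count_singleton]
  have hnd : (univ.filter fun x : ZMod (p * q) ↦
      x.val % (p * q / p) = (a : ZMod (p * q)).val % (p * q / p)).val.Nodup := Finset.nodup _
  by_cases hxb : ZMod.castHom (dvd_mul_left q p) (ZMod q) x = b₁
  · -- `x` in the full fibre: count `1` on the right
    rw [Multiset.count_eq_one_of_mem hnd (by simpa [Finset.mem_filter] using (hmem x).mpr hxb)]
    have hx0 : x ≠ 0 := fun h ↦ by rw [h, map_zero] at hxb; exact (Units.ne_zero b₁) hxb.symm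
    rcases trichotomy hpq hx0 with hxu | ⟨hxp, -⟩ | ⟨-, hxq⟩
    · rw [if_pos ⟨hxu.unit, hxu.unit_spec, by apply Units.ext; rw [coe_unitsMap, hxu.unit_spec, hxb]⟩, if_neg]
      exact fun h ↦ hyu (h ▸ hxu)
    · -- level `q`: `x = y`
      rw [if_neg, if_pos (eq_of_casts_eq hpq (hxp.trans hyp.symm) (hxb.trans hyq.symm))]
      rintro ⟨w, hw, -⟩
      exact cast_ne_zero_of_isUnit' (hw ▸ Units.isUnit w) hxp
    · exact absurd hxq (by rw [hxb]; exact Units.ne_zero b₁)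
  · -- `x` off the full fibre: count `0` on both sides
    rw [Multiset.count_eq_zero_of_notMem (by simpa [Finset.mem_filter] using fun h ↦ hxb ((hmem x).mp h))]
    rw [if_neg, if_neg]
    · exact fun h ↦ hxb (by rw [h, hyq])
    · rintro ⟨w, hw, hwb⟩
      exact hxb (by rw [← hw, ← coe_unitsMap, hwb])

/-- **S14 — CLASSIFICATION OF THE HODGE `(p+1)`-TUPLES OF LEVEL `pq`** (primes `5 ≤ p`, `p + 2 < q`):
every Hodge multiset of `p + 1` elements of `ℤ/pq` is a sum of pairs `{a, -a}` (`a ≠ 0`), or Aoki's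
standard multiset `σ_{p,a} = {a + i q : i < p} + {-p a}` of a unit `a` (in the spelling of the line's
printed supply). [cite: Aoki1983, Thm. A′ (§7) and Prop. 2.2] [cite: Aoki1987, §1 p. 387] -/
theorem stub_pqClassification :
    ∀ (p q : ℕ) [Fact p.Prime] [Fact q.Prime], 5 ≤ p → p + 2 < q →
      ∀ s : Multiset (ZMod (p * q)), IsHodgeMultiset s → Multiset.card s = p + 1 →
        (∃ Q : Multiset (ZMod (p * q)), (∀ a ∈ Q, a ≠ 0) ∧ s = Q + Q.map (fun a ↦ -a)) ∨
        ∃ a : ZMod (p * q), IsUnit a ∧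
          s = (Multiset.range p).map (fun i : ℕ ↦ a + (i : ZMod (p * q)) * ((p * q / p : ℕ) : ZMod (p * q))) +
            {-((p : ZMod (p * q)) * a)} := by
  intro p q _ _ hp hpq' s hs h6
  classical
  have hpq : p ≠ q := by omega
  rcases structure_units_pq hp hpq' hs h6 with hsym | ⟨b₁, hocc, hoff⟩
  · exact Or.inl (exists_pairs_of_symmetric_pq (by omega) (by omega) hpq hs hsym)
  right
  obtain ⟨y₀, z₀, hsyz₀⟩ := exists_eq_fibre_add_pair hpq h6 hocc
  obtain ⟨hyp₀, hzp₀, hyq₀, hzq₀, hsum₀⟩ := pair_level_q_pq hp hpq' hs hsyz₀ hoff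
  -- orient the pair so that `ȳ = b₁`
  obtain ⟨y, z, hsyz, hyp, hzp, hyq, hzq, hsum, hyb⟩ : ∃ y z : ZMod (p * q),
      s = (univ.filter fun x : (ZMod (p * q))ˣ ↦ ZMod.unitsMap (dvd_mul_left q p) x = b₁).val.map
        (fun x : (ZMod (p * q))ˣ ↦ (x : ZMod (p * q))) + {y, z} ∧
      ZMod.castHom (dvd_mul_right p q) (ZMod p) y = 0 ∧ ZMod.castHom (dvd_mul_right p q) (ZMod p) z = 0 ∧
      ZMod.castHom (dvd_mul_left q p) (ZMod q) y ≠ 0 ∧ ZMod.castHom (dvd_mul_left q p) (ZMod q) z ≠ 0 ∧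
      ZMod.castHom (dvd_mul_left q p) (ZMod q) y + ZMod.castHom (dvd_mul_left q p) (ZMod q) z =
        (1 - (p : ZMod q)) * (b₁ : ZMod q) ∧
      ZMod.castHom (dvd_mul_left q p) (ZMod q) y = b₁ := by
    have hyu : ¬ IsUnit y₀ := fun h ↦ cast_ne_zero_of_isUnit' h hyp₀
    have hzu : ¬ IsUnit z₀ := fun h ↦ cast_ne_zero_of_isUnit' h hzp₀
    rcases casts_pair_eq hp hpq' hs hsyz₀ hyu hzu with h | h
    · exact ⟨y₀, z₀, hsyz₀, hyp₀, hzp₀, hyq₀, hzq₀, hsum₀, h⟩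
    · refine ⟨z₀, y₀, by rw [hsyz₀, Multiset.pair_comm], hzp₀, hyp₀, hzq₀, hyq₀,
        by rw [add_comm]; exact hsum₀, h⟩
  have hzb : ZMod.castHom (dvd_mul_left q p) (ZMod q) z = -((p : ZMod q) * (b₁ : ZMod q)) := by
    rw [hyb] at hsum; linear_combination hsum
  -- a unit `a` of the fibre
  obtain ⟨a, -, ha⟩ := exists_unit_of_unitsMap hpq (1 : (ZMod p)ˣ) b₁
  refine ⟨a, Units.isUnit a, ?_⟩
  rw [← fibre_add_point_eq_range_map hpq a ha hyp hyb, hsyz, add_assoc]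
  congr 1
  -- `{y, z} = {y} + {-(p a)}`: `z = -p a` by its two reductions
  have hz : z = -((p : ZMod (p * q)) * a) := by
    refine eq_of_casts_eq hpq ?_ ?_
    · rw [hzp, map_neg, map_mul, map_natCast, ZMod.natCast_self, zero_mul, neg_zero]
    · rw [hzb, map_neg, map_mul, map_natCast, ← coe_unitsMap, ha]
  rw [hz, Multiset.insert_eq_cons, Multiset.singleton_add]

end LevelPQ

end Summit.HodgeConjecture.HodgeConjecture.Theorems.CancelByAnyClaimLattice.PQ
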